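import Summits.KontsevichZagierPeriods.Zeta5Search.Barrier.ConeGammaTranslateCoherentCone
import Summits.KontsevichZagierPeriods.Zeta5Search.Barrier.ConeGammaCuspSlopeLexWall

/-!
# ζ(5) search — BARRIER: LEMMA B ON THE WHOLE RATE BALL — `P(δ) − P(0) = σ(δ)` for EVERY translate with small rates, generic or
# not, by density from the rate certificate (file (3) of «THE LEXICOGRAPHIC GERM»)

HONEST FRAMING (cell `pub-zeta5`): systematic search; no irrationality claim unless kernel-certified. MODEL objects
under Brown–Zudilin's (28)+(30) accounting ([BZ22] = arXiv:2210.03391; (28) observed, not proved); nothing here is a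
statement about `ζ(5)`, any `γ` of record, the cone's supremum (C2 OPEN) or the value of `P` or `σ` at a named direction (DATA of
the cell); the radius of the rate ball at a named direction is DATA, in no statement; NO cancellation is quantified; S-E / (TD_A)
stay CONJECTURED; records in print UNMOVED. Prover P2 g42 (item «THE LEXICOGRAPHIC GERM», file (3); plan INBOX 2026-08-28).
Sources: P2 g41 `ConeGammaTranslateCoherentCone` (`translateIntegral_sub_zero_eq_cuspSlope_of_rate_sep`: `P(δ) − P(0) = σ(δ)` under
the finite RATE CERTIFICATE `|ρ_k| ≤ ρ̄`, `0 < r ≤ |ρ_k|`, `r ≤ |ρ_k − ρ_l|`, `(r + 2ρ̄)·T·x_max² ≤ 1`, `(2ρ̄ + r/2)·x_max < min(1,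
wallDist a T)` — a GENERIC translate: pairwise distinct non-zero rates), P2 g29 `ConeGammaCuspSlopeLipschitz` (`P` and `σ` are
Lipschitz), P2 g30 `ConeGammaCuspChamberCover` (`exists_forall_ne_zero_of_linear`), file (1) `ConeGammaCuspSlopeLexGerm` (sign windows).

SETTING. `a` with all 28 forms positive, `T > 0` a period, `P = translateIntegral a T`, `σ = cuspSlope a T`, rates
`ρ_k = r_k(δ) = φ_k(δ)/h_k(a)`. THE (CLOSED) RATE BALL of radius `ρ̄`: `|ρ_k| ≤ ρ̄` for all `k`, with
`2ρ̄·T·x_max(a)² < 1`, `2ρ̄·x_max(a) < 1`, `2ρ̄·x_max(a) < wallDist a T` — three strict inequalities on `ρ̄` ALONE.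
* `continuous_translateIntegral` — `P` is continuous (`56T`-Lipschitz in the sup norm, P2 g29);
* `exists_rates_separated_ne_zero` — some `v` has pairwise distinct AND non-zero rates; **`generic_window`** — along
  `ε ↦ δ + ε·v` the translate has pairwise distinct non-zero rates for ALL `0 < ε ≤ ε₀` (the generic translates are dense along
  a segment from every `δ`);
* **`translateIntegral_sub_zero_eq_cuspSlope_of_rates_le` — LEMMA B ON THE WHOLE RATE BALL**: for EVERY `δ` in the rate ball,
  **`P(δ) − P(0) = cuspSlope a T δ`** — NO genericity, NO margin, NO cluster data: `δ + ε·v` carries P2 g41's rate certificate for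
  all small `ε > 0` (margin `r` below the rate separation AND below the slack of the three strict inequalities), so the identity
  holds there, and both sides are continuous in `ε`. With P2 g19/g20's Lemma B (cluster hypotheses) and P2 g41's rate certificate
  (generic translates) this is a THIRD sufficient condition for the conical structure, stated on a full neighbourhood basis of
  the closed orbit with hypotheses on `δ` through `max_k |ρ_k|` only: on the rate ball
  `P = P(0) + σ` as FUNCTIONS — every statement about `σ` (P2 g29–g39: Lovász extension, chamber formula, kinks, rays, modulus)
  is a statement about the translate integral near the closed orbit;
* `translateIntegral_sub_eq_cuspSlope_sub_of_rates_le` — hence `P(δ) − P(δ') = σ(δ) − σ(δ')` for any two translates of the ball.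
File (4) `ConeGammaTranslateLexGerm` reads off the germ, the one-sided derivatives and the kinks of `P` at every translate of the
open ball from files (1)–(2). NOT here (honest): the rate-ball radius at a named direction (DATA); whether the rate ball contains or
is contained in Lemma B's cluster region (neither in general: two sufficient conditions); the cells of the translate arrangement
beyond the ball ((TD_A), CONJECTURED); `Φ`, `γ`, C2, S-E's truth, `ζ(5)`.
-/

noncomputable section

open Set Finset Filter
open scoped Topology

namespace Summit.KontsevichZagierPeriods.Zeta5Search.Barrier.ConeGamma

/-! ### Continuity of `P`; a fully generic direction; the generic window -/

/-- **`P` IS CONTINUOUS** in the translate (all 28 forms positive, `T > 0` a period): `56T`-Lipschitz in the sup norm by P2 g29's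
`abs_translateIntegral_sub_le`. -/
theorem continuous_translateIntegral {a : Dir} (hpos : ∀ k, 0 < h28 a k) {T : ℝ} (hT : 0 < T)
    (hper : ∀ k : Fin 28, ∃ z : ℤ, T * h28 a k = z) : Continuous (translateIntegral a T) := by
  refine (LipschitzWith.of_dist_le' (K := 56 * T) fun δ δ' => ?_).continuous
  rw [Real.dist_eq, dist_eq_norm]
  calc |translateIntegral a T δ - translateIntegral a T δ'| ≤ T * ∑ k, |phiForm (δ - δ') k| :=
        abs_translateIntegral_sub_le hpos hT.le hper δ δ'
    _ ≤ T * (56 * ‖δ - δ'‖) := mul_le_mul_of_nonneg_left (sum_abs_phiForm_le _) hT.le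
    _ = 56 * T * ‖δ - δ'‖ := by ring

/-- **A displacement with pairwise distinct AND non-zero rates exists** (all 28 forms of `a` positive): the 378 resonance
hyperplanes `φ_k/h_k = φ_l/h_l` and the 28 hyperplanes `φ_k = 0` do not cover `ℝ⁸` (P2 g30's one-parameter avoidance). -/
theorem exists_rates_separated_ne_zero {a : Dir} (hpos : ∀ k, 0 < h28 a k) :
    ∃ v : Fin 8 → ℝ, (∀ k l : Fin 28, k ≠ l → phiForm v k / h28 a k ≠ phiForm v l / h28 a l) ∧
      ∀ k, phiForm v k ≠ 0 := by
  classical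
  obtain ⟨v, hv⟩ := exists_forall_ne_zero_of_linear (Finset.univ : Finset (Fin 28 × Fin 28))
    (fun kl v => if kl.1 = kl.2 then phiForm v kl.1 else phiForm v kl.1 / h28 a kl.1 - phiForm v kl.2 / h28 a kl.2)
    (fun kl v w => by
      split_ifs
      · rw [phiForm_add]
      · rw [phiForm_add, phiForm_add]; ring)
    (fun kl t v => by
      split_ifs
      · rw [phiForm_smul]
      · rw [phiForm_smul, phiForm_smul]; ring)
    (fun kl _ => by
      by_cases h : kl.1 = kl.2
      · refine ⟨Pi.single (fstIdx kl.1) 1, ?_⟩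
        rw [if_pos h, phiForm_single_fst]
        exact one_ne_zero
      · obtain ⟨v, hv⟩ := exists_rate_sub_ne_zero hpos h
        refine ⟨v, ?_⟩
        rw [if_neg h]
        exact hv)
  refine ⟨v, fun k l hkl => ?_, fun k => ?_⟩
  · have h : (if k = l then phiForm v k else phiForm v k / h28 a k - phiForm v l / h28 a l) ≠ 0 :=
      hv (k, l) (Finset.mem_univ _)
    rw [if_neg hkl] at h
    exact sub_ne_zero.mp h
  · have h : (if k = k then phiForm v k else phiForm v k / h28 a k - phiForm v k / h28 a k) ≠ 0 :=
      hv (k, k) (Finset.mem_univ _)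
    rw [if_pos rfl] at h
    exact h

/-- **THE GENERIC WINDOW.** For every `δ` and every `v` with pairwise distinct non-zero rates there is `ε₀ > 0` such that for ALL
`0 < ε ≤ ε₀` the translate `δ + ε·v` has pairwise distinct, non-zero rates (each excluded hyperplane meets the segment in at
most one parameter; `exists_lex_window` and the sign windows of file (1) make the bound uniform). -/
theorem generic_window {a : Dir} (δ v : Fin 8 → ℝ)
    (hv : ∀ k l : Fin 28, k ≠ l → phiForm v k / h28 a k ≠ phiForm v l / h28 a l) (hv0 : ∀ k, phiForm v k ≠ 0) :
    ∃ ε₀ : ℝ, 0 < ε₀ ∧ ∀ ε : ℝ, 0 < ε → ε ≤ ε₀ →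
      (∀ k l : Fin 28, k ≠ l → phiForm (δ + ε • v) k / h28 a k ≠ phiForm (δ + ε • v) l / h28 a l) ∧
        ∀ k, phiForm (δ + ε • v) k ≠ 0 := by
  obtain ⟨t₁, ht₁, h₁⟩ := exists_lex_window a δ v
  obtain ⟨t₂, ht₂, h₂⟩ := exists_common_window (Finset.univ : Finset (Fin 28))
    (fun k ε => phiForm (δ + ε • v) k ≠ 0) (fun k _ => by
      obtain ⟨s₁, hs₁, hw₁⟩ := sign_window (phiForm δ k) (phiForm v k)
      obtain ⟨s₂, hs₂, hw₂⟩ := sign_window (-phiForm δ k) (-phiForm v k)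
      refine ⟨min s₁ s₂, lt_min hs₁ hs₂, fun ε hε hle h0 => ?_⟩
      rw [phiForm_add, phiForm_smul] at h0
      have e1 := hw₁ ε hε (hle.trans (min_le_left _ _))
      have e2 := hw₂ ε hε (hle.trans (min_le_right _ _))
      have n1 : ¬(0 < phiForm δ k + ε * phiForm v k) := by rw [h0]; exact lt_irrefl 0
      have n2 : ¬(0 < -phiForm δ k + ε * -phiForm v k) := by
        rw [show -phiForm δ k + ε * -phiForm v k = -(phiForm δ k + ε * phiForm v k) by ring, h0, neg_zero]
        exact lt_irrefl 0
      rw [e1, not_or, not_lt, not_and, not_lt] at n1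
      rw [e2, not_or, not_lt, not_and, not_lt] at n2
      have hp : phiForm δ k = 0 := by linarith [n1.1, n2.1]
      have h3 := n1.2 hp
      have h4 := n2.2 (by rw [hp, neg_zero])
      exact hv0 k (by linarith))
  refine ⟨min t₁ t₂, lt_min ht₁ ht₂, fun ε hε hle => ⟨fun k l hkl h => ?_,
    fun k => h₂ ε hε (hle.trans (min_le_right _ _)) k (Finset.mem_univ _)⟩⟩
  have hw := h₁ ε hε (hle.trans (min_le_left _ _))
  rcases lt_trichotomy (phiForm δ k / h28 a k) (phiForm δ l / h28 a l) with hkl' | hkl' | hkl'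
  · exact absurd h ((hw k l).mpr (Or.inl hkl')).ne
  · rcases (hv k l hkl).lt_or_gt with hv' | hv'
    · exact absurd h ((hw k l).mpr (Or.inr ⟨hkl', hv'⟩)).ne
    · exact absurd h.symm ((hw l k).mpr (Or.inr ⟨hkl'.symm, hv'⟩)).ne
  · exact absurd h.symm ((hw l k).mpr (Or.inl hkl')).ne

/-! ### LEMMA B on the whole rate ball -/

/-- Numeric bookkeeping of the density argument: with a slack `s` below the three strict inequalities of the rate ball,
`K = T·x² + x + 1`, a margin `r` with `4K·r ≤ s` and a step `ε` with `4K(C+1)·ε ≤ s`, the rate bound `ρ̄ + ε·C` and the margin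
`r` satisfy the three side conditions of P2 g41's rate certificate. -/
theorem rateBall_slack {ρb T x w C ε r s : ℝ} (hT : 0 < T) (hx : 0 < x) (hC : 0 ≤ C) (hε : 0 < ε) (hr : 0 < r)
    (hs1 : s ≤ 1 - 2 * ρb * T * x ^ 2) (hs2 : s ≤ 1 - 2 * ρb * x) (hs3 : s ≤ w - 2 * ρb * x)
    (hrs : r * (4 * (T * x ^ 2 + x + 1)) ≤ s) (hεs : ε * (4 * (T * x ^ 2 + x + 1) * (C + 1)) ≤ s) :
    (r + 2 * (ρb + ε * C)) * T * x ^ 2 ≤ 1 ∧ (2 * (ρb + ε * C) + r / 2) * x < 1 ∧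
      (2 * (ρb + ε * C) + r / 2) * x < w := by
  have hTx : 0 ≤ T * x ^ 2 := mul_nonneg hT.le (sq_nonneg x)
  obtain ⟨K, hK⟩ : ∃ K : ℝ, K = T * x ^ 2 + x + 1 := ⟨_, rfl⟩
  rw [← hK] at hrs hεs
  have hK0 : 0 < K := by rw [hK]; linarith
  have hK1 : T * x ^ 2 ≤ K := by rw [hK]; linarith
  have hK2 : x ≤ K := by rw [hK]; linarith
  have h1 : r * K ≤ s / 4 := by linarith
  have h2 : ε * C * K ≤ s / 4 := by
    have h3 : ε * C * K ≤ ε * (C + 1) * K :=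
      mul_le_mul_of_nonneg_right (mul_le_mul_of_nonneg_left (by linarith) hε.le) hK0.le
    calc ε * C * K ≤ ε * (C + 1) * K := h3
      _ = ε * (4 * K * (C + 1)) / 4 := by ring
      _ ≤ s / 4 := div_le_div_of_nonneg_right hεs (by norm_num)
  have hrK : 0 < r * K := mul_pos hr hK0
  have hb : (r + 2 * (ε * C)) * K < s := by nlinarith
  have hεC : 0 ≤ ε * C := mul_nonneg hε.le hC
  have hA : (r + 2 * (ε * C)) * (T * x ^ 2) ≤ (r + 2 * (ε * C)) * K :=
    mul_le_mul_of_nonneg_left hK1 (by linarith)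
  have hB : (2 * (ε * C) + r / 2) * x ≤ (r + 2 * (ε * C)) * K :=
    mul_le_mul (by linarith) hK2 hx.le (by linarith)
  refine ⟨?_, ?_, ?_⟩
  · calc (r + 2 * (ρb + ε * C)) * T * x ^ 2 = 2 * ρb * T * x ^ 2 + (r + 2 * (ε * C)) * (T * x ^ 2) := by ring
      _ ≤ (1 - s) + (r + 2 * (ε * C)) * K := add_le_add (by linarith) hA
      _ ≤ 1 := by linarith
  · calc (2 * (ρb + ε * C) + r / 2) * x = 2 * ρb * x + (2 * (ε * C) + r / 2) * x := by ring
      _ ≤ (1 - s) + (r + 2 * (ε * C)) * K := add_le_add (by linarith) hB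
      _ < 1 := by linarith
  · calc (2 * (ρb + ε * C) + r / 2) * x = 2 * ρb * x + (2 * (ε * C) + r / 2) * x := by ring
      _ ≤ (w - s) + (r + 2 * (ε * C)) * K := add_le_add (by linarith) hB
      _ < w := by linarith

/-- **A translate with pairwise distinct non-zero rates has a rate margin below any prescribed bound**: for `η > 0` some
`0 < r ≤ η` has `r ≤ |ρ_k|` for all `k` and `r ≤ |ρ_k − ρ_l|` for all `k ≠ l`. -/
theorem exists_rate_margin {a : Dir} (hpos : ∀ k, 0 < h28 a k) {θ : Fin 8 → ℝ}
    (hgen : ∀ k l : Fin 28, k ≠ l → phiForm θ k / h28 a k ≠ phiForm θ l / h28 a l) (hnz : ∀ k, phiForm θ k ≠ 0)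
    {η : ℝ} (hη : 0 < η) :
    ∃ r : ℝ, 0 < r ∧ r ≤ η ∧ (∀ k, r ≤ |phiForm θ k / h28 a k|) ∧
      ∀ k l : Fin 28, k ≠ l → r ≤ |phiForm θ k / h28 a k - phiForm θ l / h28 a l| := by
  classical
  obtain ⟨m₁, hm₁⟩ : ∃ m₁ : ℝ, m₁ = (Finset.univ : Finset (Fin 28)).inf' Finset.univ_nonempty
      fun k => |phiForm θ k / h28 a k| := ⟨_, rfl⟩
  have hne₂ : ((Finset.univ : Finset (Fin 28 × Fin 28)).filter fun kl => kl.1 ≠ kl.2).Nonempty :=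
    ⟨(0, 1), Finset.mem_filter.mpr ⟨Finset.mem_univ _, by decide⟩⟩
  obtain ⟨m₂, hm₂⟩ : ∃ m₂ : ℝ, m₂ = ((Finset.univ : Finset (Fin 28 × Fin 28)).filter fun kl => kl.1 ≠ kl.2).inf' hne₂
      fun kl => |phiForm θ kl.1 / h28 a kl.1 - phiForm θ kl.2 / h28 a kl.2| := ⟨_, rfl⟩
  have hm₁0 : 0 < m₁ := by
    rw [hm₁, Finset.lt_inf'_iff]
    exact fun k _ => abs_pos.mpr (div_ne_zero (hnz k) (hpos k).ne')
  have hm₂0 : 0 < m₂ := by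
    rw [hm₂, Finset.lt_inf'_iff]
    exact fun kl hkl => abs_pos.mpr (sub_ne_zero.mpr (hgen _ _ (Finset.mem_filter.mp hkl).2))
  have hm₁le : ∀ k, m₁ ≤ |phiForm θ k / h28 a k| := fun k => by
    rw [hm₁]; exact Finset.inf'_le (fun k => |phiForm θ k / h28 a k|) (Finset.mem_univ k)
  have hm₂le : ∀ k l : Fin 28, k ≠ l → m₂ ≤ |phiForm θ k / h28 a k - phiForm θ l / h28 a l| := fun k l hkl => by
    rw [hm₂]
    exact Finset.inf'_le (fun kl : Fin 28 × Fin 28 => |phiForm θ kl.1 / h28 a kl.1 - phiForm θ kl.2 / h28 a kl.2|)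
      (Finset.mem_filter.mpr ⟨Finset.mem_univ (k, l), hkl⟩)
  refine ⟨min η (min m₁ m₂), lt_min hη (lt_min hm₁0 hm₂0), min_le_left _ _, fun k => ?_, fun k l hkl => ?_⟩
  · exact (min_le_right _ _).trans ((min_le_left _ _).trans (hm₁le k))
  · exact (min_le_right _ _).trans ((min_le_right _ _).trans (hm₂le k l hkl))

/-- A continuous real function vanishing on a window `(0, ε₁]` vanishes at `0`. -/
theorem apply_zero_eq_zero_of_window {f : ℝ → ℝ} (hf : Continuous f) {ε₁ : ℝ} (hε₁ : 0 < ε₁)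
    (h : ∀ ε, 0 < ε → ε ≤ ε₁ → f ε = 0) : f 0 = 0 := by
  have hseq : Tendsto (fun n : ℕ => ε₁ * (1 / ((n : ℝ) + 1))) atTop (𝓝 0) := by
    simpa using tendsto_one_div_add_atTop_nhds_zero_nat.const_mul ε₁
  have hlim1 := (hf.tendsto 0).comp hseq
  have hzero : ∀ n : ℕ, f (ε₁ * (1 / ((n : ℝ) + 1))) = 0 := fun n => by
    have hn : (0 : ℝ) < (n : ℝ) + 1 := by positivity
    refine h _ (mul_pos hε₁ (by positivity)) ?_
    rw [mul_one_div]
    exact div_le_self hε₁.le (by linarith)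
  have hlim2 : Tendsto (fun n : ℕ => f (ε₁ * (1 / ((n : ℝ) + 1)))) atTop (𝓝 0) := by
    simp only [hzero]
    exact tendsto_const_nhds
  exact tendsto_nhds_unique hlim1 hlim2

/-- **LEMMA B ON THE WHOLE RATE BALL — `P(δ) − P(0) = σ(δ)` WITH NO GENERICITY.** All 28 forms of `a` positive, `T > 0` a period;
`δ` ANY translate with `|φ_k(δ)/h_k(a)| ≤ ρ̄` for all `k`, where `2ρ̄·T·x_max(a)² < 1`, `2ρ̄·x_max(a) < 1` and
`2ρ̄·x_max(a) < wallDist a T`. Then **`translateIntegral a T δ − translateIntegral a T 0 = cuspSlope a T δ`**. (Density: the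
translates `δ + ε·v` of the generic window carry P2 g41's rate certificate with the rate bound `ρ̄ + ε·C` and a margin below both the
rate separation and the slack of the three strict inequalities; `P` and `σ` are continuous.) -/
theorem translateIntegral_sub_zero_eq_cuspSlope_of_rates_le {a : Dir} (hpos : ∀ k, 0 < h28 a k) {T : ℝ} (hT : 0 < T)
    (hper : ∀ k : Fin 28, ∃ z : ℤ, T * h28 a k = z) {δ : Fin 8 → ℝ} {ρb : ℝ}
    (hρ : ∀ k, |phiForm δ k / h28 a k| ≤ ρb) (hρT : 2 * ρb * T * xMax a ^ 2 < 1) (hc1 : 2 * ρb * xMax a < 1)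
    (hc2 : 2 * ρb * xMax a < wallDist a T) :
    translateIntegral a T δ - translateIntegral a T 0 = cuspSlope a T δ := by
  have hx : 0 < xMax a := xMax_pos hpos
  obtain ⟨v, hv, hv0⟩ := exists_rates_separated_ne_zero hpos
  obtain ⟨ε₀, hε₀, hgenε⟩ := generic_window δ v hv hv0
  -- the size of the rates of `v`
  obtain ⟨C, hC⟩ : ∃ C : ℝ, C = ∑ k, |phiForm v k / h28 a k| := ⟨_, rfl⟩
  have hC0 : 0 ≤ C := by rw [hC]; exact Finset.sum_nonneg fun k _ => abs_nonneg _
  have hCk : ∀ k, |phiForm v k / h28 a k| ≤ C := fun k => by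
    rw [hC]; exact Finset.single_le_sum (fun k _ => abs_nonneg (phiForm v k / h28 a k)) (Finset.mem_univ k)
  -- the slack of the three strict inequalities and the size constant `K`
  obtain ⟨s, hs⟩ : ∃ s : ℝ, s = min (1 - 2 * ρb * T * xMax a ^ 2)
      (min (1 - 2 * ρb * xMax a) (wallDist a T - 2 * ρb * xMax a)) := ⟨_, rfl⟩
  have hs0 : 0 < s := by rw [hs]; exact lt_min (by linarith) (lt_min (by linarith) (by linarith))
  have hs1 : s ≤ 1 - 2 * ρb * T * xMax a ^ 2 := by rw [hs]; exact min_le_left _ _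
  have hs2 : s ≤ 1 - 2 * ρb * xMax a := by rw [hs]; exact (min_le_right _ _).trans (min_le_left _ _)
  have hs3 : s ≤ wallDist a T - 2 * ρb * xMax a := by rw [hs]; exact (min_le_right _ _).trans (min_le_right _ _)
  obtain ⟨K, hK⟩ : ∃ K : ℝ, K = T * xMax a ^ 2 + xMax a + 1 := ⟨_, rfl⟩
  have hK0 : 0 < K := by rw [hK]; have h1 := mul_nonneg hT.le (sq_nonneg (xMax a)); linarith
  have h4K : 0 < 4 * K := by linarith
  have h4KC : 0 < 4 * K * (C + 1) := mul_pos h4K (by linarith)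
  -- the step `ε₁`
  obtain ⟨ε₁, hε₁⟩ : ∃ ε₁ : ℝ, ε₁ = min ε₀ (s / (4 * K * (C + 1))) := ⟨_, rfl⟩
  have hε₁0 : 0 < ε₁ := by rw [hε₁]; exact lt_min hε₀ (div_pos hs0 h4KC)
  have hε₁le : ε₁ ≤ ε₀ := by rw [hε₁]; exact min_le_left _ _
  have hε₁le' : ε₁ ≤ s / (4 * K * (C + 1)) := by rw [hε₁]; exact min_le_right _ _
  -- the identity at every translate of the window
  have hid : ∀ ε, 0 < ε → ε ≤ ε₁ →
      translateIntegral a T (δ + ε • v) - translateIntegral a T 0 = cuspSlope a T (δ + ε • v) := by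
    intro ε hε hle
    obtain ⟨hgen, hnz⟩ := hgenε ε hε (hle.trans hε₁le)
    have hρε : ∀ k, |phiForm (δ + ε • v) k / h28 a k| ≤ ρb + ε * C := fun k => by
      rw [rate_add_smul]
      calc |phiForm δ k / h28 a k + ε * (phiForm v k / h28 a k)| ≤
          |phiForm δ k / h28 a k| + |ε * (phiForm v k / h28 a k)| := abs_add_le _ _
        _ ≤ ρb + ε * C := add_le_add (hρ k) (by
          rw [abs_mul, abs_of_pos hε]; exact mul_le_mul_of_nonneg_left (hCk k) hε.le)
    obtain ⟨r, hr0, hrη, hr1, hr2⟩ := exists_rate_margin hpos hgen hnz (div_pos hs0 h4K)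
    have hrs : r * (4 * (T * xMax a ^ 2 + xMax a + 1)) ≤ s := by
      rw [← hK]; exact (le_div_iff₀ h4K).mp hrη
    have hεs : ε * (4 * (T * xMax a ^ 2 + xMax a + 1) * (C + 1)) ≤ s := by
      rw [← hK]; exact (le_div_iff₀ h4KC).mp (hle.trans hε₁le')
    obtain ⟨hrT, hc1', hc2'⟩ := rateBall_slack hT hx hC0 hε hr0 hs1 hs2 hs3 hrs hεs
    exact translateIntegral_sub_zero_eq_cuspSlope_of_rate_sep hpos hT hper hr0 hρε hr1 hr2 hrT hc1' hc2'
  -- pass to the limit `ε → 0⁺`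
  have hl : Continuous fun ε : ℝ => δ + ε • v := continuous_const.add (continuous_id.smul continuous_const)
  have hf : Continuous fun ε : ℝ =>
      translateIntegral a T (δ + ε • v) - translateIntegral a T 0 - cuspSlope a T (δ + ε • v) :=
    (((continuous_translateIntegral hpos hT hper).comp hl).sub continuous_const).sub
      ((continuous_cuspSlope hpos hT hper).comp hl)
  have h0 := apply_zero_eq_zero_of_window hf hε₁0 fun ε hε hle => by
    show translateIntegral a T (δ + ε • v) - translateIntegral a T 0 - cuspSlope a T (δ + ε • v) = 0
    rw [hid ε hε hle, sub_self]
  simp only [zero_smul, add_zero] at h0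
  linarith

/-- **On the rate ball `P` and `σ` differ by the constant `P(0)`**: for any two translates `δ, δ'` of the ball,
`P(δ) − P(δ') = cuspSlope a T δ − cuspSlope a T δ'`. -/
theorem translateIntegral_sub_eq_cuspSlope_sub_of_rates_le {a : Dir} (hpos : ∀ k, 0 < h28 a k) {T : ℝ} (hT : 0 < T)
    (hper : ∀ k : Fin 28, ∃ z : ℤ, T * h28 a k = z) {δ δ' : Fin 8 → ℝ} {ρb : ℝ}
    (hρ : ∀ k, |phiForm δ k / h28 a k| ≤ ρb) (hρ' : ∀ k, |phiForm δ' k / h28 a k| ≤ ρb)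
    (hρT : 2 * ρb * T * xMax a ^ 2 < 1) (hc1 : 2 * ρb * xMax a < 1) (hc2 : 2 * ρb * xMax a < wallDist a T) :
    translateIntegral a T δ - translateIntegral a T δ' = cuspSlope a T δ - cuspSlope a T δ' := by
  have h1 := translateIntegral_sub_zero_eq_cuspSlope_of_rates_le hpos hT hper hρ hρT hc1 hc2
  have h2 := translateIntegral_sub_zero_eq_cuspSlope_of_rates_le hpos hT hper hρ' hρT hc1 hc2
  linarith

end Summit.KontsevichZagierPeriods.Zeta5Search.Barrier.ConeGamma

end
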